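import Summits.BirchSwinnertonDyer.BirchSwinnertonDyer.Theses.GenusKolyvaginAtTwo
import Summits.BirchSwinnertonDyer.BirchSwinnertonDyer.Theorems.GenusKolyvaginAtTwoPowDvdShaCardAtTwoRTLadderFrame
import HarnessLib

/-!
# Route `GenusKolyvaginAtTwo`, LINE 18 v5 (L_T `PowDvdShaCardAtTwoRT`, stmt-BirchSwinnertonDyer-23242) — stub J
# `stub_jointGenusCountAtTwo` IS FALSE ON ANY TWO-SIDED GENUS ROW (negative-modulo anchor)

Seat `bsd-line-gk2-p3` g20 (cell `bsd-f1-sign2`), `--supports stmt-BirchSwinnertonDyer-23242` (helper; closes nothing, refutes no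
route item: J is a stub of the pen's skeleton, not a route decl).  THEOREMS ONLY (no definition, no named fact, no `sorry`).
BSD is NOT proved by any of this; L_T is NOT proved.

WHAT.  The registered stub J of skeleton v5 (`Cruxes/PowDvdShaCardAtTwoRT/Lines/plus_descent.lean`, `stub_jointGenusCountAtTwo`;
its statement is reproduced VERBATIM as the negated conclusion below) asserts, for the two ℚ-side ladders of stub L on the deep
genus regime `2 ≤ B := ord₂ C(Wd)`, the cross-side count `2·M₀ ≤ ord₂ #Ш(W)[2^∞] + ord₂ #Ш(Wd)[2^∞] + B` — for ANY antitone
ladder `M` with the displayed families, whatever their provenance.  **`not_stub_jointGenusCountAtTwo_of_genusRow`**: J fails as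
soon as ONE «two-sided genus row» exists — `W, K, Wd` as in J with `ord₂ C(Wd) = 3`, `#Ш(W)[2^∞] = #Ш(Wd)[2^∞] = 1`, and two
independent classes of order `2` in EACH relaxed group `res⁻¹(Ш(W_K/K)) ≤ H¹(ℚ, W)`, `res⁻¹(Ш(Wd_K/K)) ≤ H¹(ℚ, Wd)` (the FAKE
ladder `T = 1`, `M = (2, 1, 0, …)` then meets every hypothesis of J while its conclusion reads `4 ≤ 0 + 0 + 3`).  Such rows are the
route's own frame rows at `B = 3` with `Sel₂(W) = 0`, `Sel₂(Wd) = ℤ/2` of rank `1`: there the relaxed groups have 𝔽₂-dimension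
`B − rank − dim E(ℚ)[2] + dim Φ ≥ 3` resp. `≥ 2` by Kramer's genus theory for classes of order `2` (Trans. AMS 264 (1981) §4,
exact sequence (13) and the Remark after Cor. 2: «an analog of genus theory for elements of order 2»; Prop. 3 for the local norm
index `i_p = dim Ẽ(𝔽_p)[2]` at the ramified good odd `p ∣ d_K`) — see the seat's memo `Lines/plus-descent-stubJ-audit.md` on the
crux.  The companion lemma `two_mul_two_le_iff_false` is the arithmetic of the fake ladder, isolated.

References: [Kramer1981] §2 Prop. 3, §4 (11)–(13); [McCallumLMS1991] §5 Thm. 5.4 (the count J imitates); [MazurRubin2010] Lemma 2.11.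
-/

set_option autoImplicit false
-- the Theorems namespace of this sub repeats the summit name by design (D-0017 nested layout)
set_option linter.dupNamespace false

noncomputable section

open scoped Classical

namespace Summit.BirchSwinnertonDyer.BirchSwinnertonDyer.Theorems.GenusExact.PlusDescent

open WeierstrassCurve NumberField Literature.NumberTheory.EllipticCurves

/-- **Stub J of LINE 18 v5 is false on any two-sided genus row.**  If there is ONE datum `(W, K, Wd)` in J's own frame
(`W` globally minimal with `C(W)` odd and `Δ_W < 0`; `K` imaginary quadratic with odd `d_K`, Heegner for `N_W`; `Wd` a globally
minimal model of `W^{(d_K)}`) with `ord₂ C(Wd) = 3`, `#Ш(W/ℚ)[2^∞] = #Ш(Wd/ℚ)[2^∞] = 1`, and two independent classes of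
order `2` in `H¹(ℚ, W)` restricting into `Ш(W_K/K)` and two in `H¹(ℚ, Wd)` restricting into `Ш(Wd_K/K)` (Kramer's genus classes),
then the registered statement of `stub_jointGenusCountAtTwo` (reproduced verbatim under the negation) is false: instantiate it at
`M₀ = 2`, `T = 1`, `M j = 2 − j`.  [cite: Kramer1981, §4 (13) and Remark after Cor. 2] [cite: McCallumLMS1991, §5 Thm. 5.4] -/
theorem not_stub_jointGenusCountAtTwo_of_genusRow
    (W : WeierstrassCurve ℚ) [W.IsElliptic] [W.IsGloballyMinimal] (hT : Odd W.tamagawaProduct) (hΔ : W.Δ < 0)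
    (K : Type) [Field K] [NumberField K] (hIQ : Literature.NumberTheory.EllipticCurves.IsImaginaryQuadratic K)
    (hodd : Odd (NumberField.discr K))
    (hHe : Literature.NumberTheory.EllipticCurves.SatisfiesHeegnerHypothesis (W.conductorNorm ℤ) K)
    (Wd : WeierstrassCurve ℚ) [Wd.IsElliptic] [Wd.IsGloballyMinimal]
    (hTw : ∃ C : WeierstrassCurve.VariableChange ℚ, C • W.quadraticTwist (NumberField.discr K : ℚ) = Wd)
    (hB : padicValNat 2 Wd.tamagawaProduct = 3)
    (hg : Nat.card (AddCommGroup.primaryComponent W.sha 2) = 1)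
    (hg' : Nat.card (AddCommGroup.primaryComponent Wd.sha 2) = 1)
    (x : Fin 2 → W.galH1) (hx : ∀ i, resBaseChange W K (x i) ∈ (W.baseChange K).sha) (hxord : ∀ i, addOrderOf (x i) = 2)
    (hxind : ∀ c : Fin 2 → ℤ, ∑ i, c i • x i = 0 → ∀ i, (2 : ℤ) ∣ c i)
    (y : Fin 2 → Wd.galH1) (hy : ∀ i, resBaseChange Wd K (y i) ∈ (Wd.baseChange K).sha) (hyord : ∀ i, addOrderOf (y i) = 2)
    (hyind : ∀ c : Fin 2 → ℤ, ∑ i, c i • y i = 0 → ∀ i, (2 : ℤ) ∣ c i) :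
    ¬ (∀ (W : WeierstrassCurve ℚ) [W.IsElliptic] [W.IsGloballyMinimal], Odd W.tamagawaProduct → W.Δ < 0 → ∀ (K : Type) [Field K] [NumberField K], Literature.NumberTheory.EllipticCurves.IsImaginaryQuadratic K → Odd (NumberField.discr K) → Literature.NumberTheory.EllipticCurves.SatisfiesHeegnerHypothesis (W.conductorNorm ℤ) K → ∀ (M₀ : ℕ) (Wd : WeierstrassCurve ℚ) [Wd.IsElliptic] [Wd.IsGloballyMinimal], (∃ C : WeierstrassCurve.VariableChange ℚ, C • W.quadraticTwist (NumberField.discr K : ℚ) = Wd) → 2 ≤ padicValNat 2 Wd.tamagawaProduct → 0 < Nat.card (AddCommGroup.primaryComponent W.sha 2) → 0 < Nat.card (AddCommGroup.primaryComponent Wd.sha 2) → ∀ (T : ℕ) (M : ℕ → ℕ), (∀ j, M (j + 1) ≤ M j) → M 0 = M₀ → M (2 * T) = 0 → (∀ m < T, ∃ x : Fin (2 * m + 2) → W.galH1, (∀ i, resBaseChange W K (x i) ∈ (W.baseChange K).sha) ∧ (∀ i, addOrderOf (x i) = 2 ^ (M (2 * m) - M (2 * m + 1))) ∧ ∀ c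 : Fin (2 * m + 2) → ℤ, ∑ i, c i • x i = 0 → ∀ i, ((2 ^ (M (2 * m) - M (2 * m + 1)) : ℕ) : ℤ) ∣ c i) → (∀ m < T, ∃ x : Fin (2 * m + 2) → Wd.galH1, (∀ i, resBaseChange Wd K (x i) ∈ (Wd.baseChange K).sha) ∧ (∀ i, addOrderOf (x i) = 2 ^ (M (2 * m + 1) - M (2 * m + 2))) ∧ ∀ c : Fin (2 * m + 2) → ℤ, ∑ i, c i • x i = 0 → ∀ i, ((2 ^ (M (2 * m + 1) - M (2 * m + 2)) : ℕ) : ℤ) ∣ c i) → (2 * M₀ : ℤ) ≤ (padicValNat 2 (Nat.card (AddCommGroup.primaryComponent W.sha 2)) : ℤ) + (padicValNat 2 (Nat.card (AddCommGroup.primaryComponent Wd.sha 2)) : ℤ) + (padicValNat 2 Wd.tamagawaProduct : ℤ)) := by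
  intro hJ
  -- the fake ladder: `M₀ = 2`, `T = 1`, `M = (2, 1, 0, 0, …)`
  have h := hJ W hT hΔ K hIQ hodd hHe 2 Wd hTw (by omega) (by omega) (by omega) 1 (fun j ↦ 2 - j)
    (fun j ↦ Nat.sub_le_sub_left (Nat.le_succ j) 2) rfl rfl ?_ ?_
  · rw [hg, hg', hB, padicValNat_one_right] at h
    norm_num at h
  · intro m hm
    obtain rfl : m = 0 := by omega
    exact ⟨x, hx, fun i ↦ by rw [hxord i]; norm_num, fun c hc i ↦ by simpa using hxind c hc i⟩
  · intro m hm
    obtain rfl : m = 0 := by omega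
    exact ⟨y, hy, fun i ↦ by rw [hyord i]; norm_num, fun c hc i ↦ by simpa using hyind c hc i⟩

end Summit.BirchSwinnertonDyer.BirchSwinnertonDyer.Theorems.GenusExact.PlusDescent

end
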